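import Literature.MathematicalPhysics.QuantumFieldTheory.Balaban1983to89.B6DomainChange
import Literature.MathematicalPhysics.QuantumFieldTheory.Balaban1983to89.B9Eq395Small

/-!
# `Balaban1983to89.B6DomainTerm282` — the THIRD LINE of B6 (2.82), p. 237: the domain-change term
`□Q′(G′(□̃)² − G′²)Q′*h_□C_□h_□` (= B9 (3.97), p. 412): the window (1.12)-shape of `Q′G′²Q′*` on two carriers, the
indicator absorption `□̃·D·□`, and the resulting e^{−2δ₀M} majorant — the hypothesis `hD` of
`B9Eq395Small.term397_majorant` DERIVED from a window-only hypothesis of the printed shape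

B6 = T. Bałaban, *Propagators and renormalization transformations for lattice gauge theories. II*, Commun. Math. Phys.
**96**, 223–250 (1984) [`Balaban1984PropagatorsII`] (doi:10.1007/bf01240221, held `paper:balaban1984-cmp96-propagators-rt-ii`;
journal page = PDF page + 222).  B9 = T. Bałaban, *Propagators for lattice gauge theories in a background field*,
Commun. Math. Phys. **99**, 389–434 (1985) [`Balaban1985BackgroundPropagators`] (journal page = PDF page + 388).
[3] (of B6) = [2] (of B9) = T. Bałaban, *Regularity and decay of lattice Green's functions*, Commun. Math. Phys. **89**,
571–597 (1983) [`Balaban1983RegularityDecay`] (= B4).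

CITATION HEADER (lean-in-tree rule 2026-08-18).  Cell `pub-balaban`, unit `b2b-balaban-b06-g7` (PAPER SUB-CELL B06,
gen 7 — the owner lineage of `…B6`, `…B6RandomWalk`-siblings `…B6KernelComposition`, `…B6WeightedEncoding`,
`…B6Ineq268`, `…B6Ineq283`, `…B6DomainChange`), journal claim LINE282-3-KERNEL; cell rows GAPS C-b06g7-1,
DIVERGENCE D-b06.19.  Every quotation below was read from the x2 page renders
`b2b-balaban-ref1/pages/1984-cmp96-propagators-rt-II/1984-cmp96-propagators-rt-II-p007-x2.png` (p. 229),
`…-p013-x2.png` (p. 235), `…-p015-x2.png` (p. 237), `…-p016-x2.png` (p. 238) and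
`b2b-balaban-ref1/pages/1985-cmp99-background-propagators/1985-cmp99-background-propagators-p024-x2.png` (B9 p. 412)
AS IMAGES, not from an OCR layer.  No existing module is modified: this module imports `…B6DomainChange` (b06-g6,
p181264) and `…B9Eq395Small` (b09-g6, p180278) and touches nothing else.

WHAT IS PRINTED (verbatim).
* B6 p. 229 [PDF 7]: *"We cover B^j(Λ_j) by a sum of cubes □ of the size 2ML^jη, each cube being a sum of 2^d big
  blocks with a center y ∈ Λ_j"* … *"We construct also the corresponding family of functions h described in (1.118),
  and rescale them to proper scales. They satisfy Σ_{□∈𝒟} h²_□ = 1. (2.36)"*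
* B6 p. 235 [PDF 13]: *"We change this prescription a little bit; we take a second cube □̃ containing □ in the middle
  and of the size 4M and we take an inverse of the operator (Q′G′(□̃)²Q′*)↾_□ instead of (Q′G′²Q′*)↾_□. Let us define
  C_□ = ((Q′G′(□̃)²Q′*)↾_□)^{−1}, C = Σ_{□∈𝒟} h_□C_□h_□. (2.70)"*
* B6 p. 237 [PDF 15], (2.82): *"We will show that Q′G′²Q′*C is a good approximation of identity. We have
  Q′G′²Q′*C = Σ_{□∈𝒟} Q′G′²Q′*h_□C_□h_□ = Σ_□ h_□(□Q′G′(□̃)²Q′*□)C_□h_□ − Σ_□ [h_□, □Q′G′(□̃)²Q′*□]C_□h_□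
  − Σ_□ □Q′(G′(□̃)² − G′²)Q′*h_□C_□h_□ − Σ_{□,□′≠□} (□ − 1)h²_{□′}Q′G′²Q′*h_□C_□h_□ = I − Σ_{□,□′} R_{□,□′}C_{□′}h_{□′}
  = I − R, (2.82) with an obvious definition of the operators R_{□,□′}."*
* B6 p. 238 [PDF 16]: *"Similar inequalities hold for kernels of the other operators forming R, for example the operator
  with G′(□̃)² − G′² is small and an estimate has the factor e^{−δ₀M} because of the usual estimate of the type (1.12)
  [3] connected with a change of a domain. This estimate follows from the random walk representations (2.50) for the
  operators G′, G′(□̃)."*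
* B9 p. 412 [PDF 24]: *"i.e. we take □̃Q′(G′²_{□₀} − G′²_□)Q′*h_□C_□h_□. (3.97) We have proved in [2] that if we have a
  difference of propagators defined on two domains, then in an estimate of this difference we have, besides the usual
  factors connected with propagators of a considered type, an exponential factor with a distance between
  localizations and a closest point where a change was made."* … *"Hence, they are valid in the considered case, and
  the differences □̃Q′(G′²_{□₀} − G′²_□)Q′*□ can be estimated by the usual factors multiplied by e^{−2δ₀M}. We have to
  notice only that the operators may differ outside □̃₀, and the distance from □̃ to □̃₀ᶜ is at least M (on
  L^{−j}-scale). This exponential can be estimated by (2δ₀M)^{−1} and we consider the operator (3.97) as on factor in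
  the expansion."*

THE READING (typed objects; every choice is recorded in the cell's DIVERGENCE D-b06.19).
(a) §1 — THE WINDOW SHAPE.  As in `…B6DomainChange` (D-b06.18): a point set `S` with a pseudo-distance `ρ`, a depth
    `β` (`IsDepth`: ≥ 0, ρ-Lipschitz; the printed "distance … to a closest point where a change was made") and a
    summation profile `K`; two CARRIERS `n₁` (the lattice on which G′ = (Δ′_a)⁻¹ lives) and `n₂` (the cube □̃ on which
    G′(□̃) — B9: G′_{□₀} — lives, *"an inverse of Δ′_a with some boundary conditions on the boundary of □"*, p. 229),
    with kernels `A₁`, `A₂` satisfying the placed (5.6) of [3] (`B4Sect5Torus.Hyp56`) and AGREEING on a window `m ↪ n_c`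
    off which the depth vanishes; `Q₁`, `Q₂` (the Q′ of the two carriers) decaying (`Decay … cQ δ₀`) and agreeing on
    the window; Q′* is the transpose (the pairing weights are absorbed into Q, as in `…B6DomainChange` §C).  Then
    `qggq_window_agree`: the compressions to the window of `B_c = Q_cA_c⁻¹(Q_cA_c⁻¹)ᵀ = Q_c(A_c⁻¹A_c⁻¹)Q_cᵀ`
    (`qAinv_mul_transpose_eq`: this IS Q′G′²Q′*) differ by a kernel of the (1.12)-SHAPE
    `|·(i,j)| ≤ ε_B·e^{−(r_A/9)(ρ(i,j) + β(i) + β(j))}` with `ε_B = B6DomainChange.epsB K γ₀ c₀ δ₀ cQ`,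
    `r_A = B6DomainChange.rA K γ₀ c₀ δ₀` — explicit functions of the structural constants ONLY (this is the Step B of
    `B6DomainChange.projection_window_agree`, exported); `qggq_window_deep`: at two indices of depth ≥ M the
    difference is ≤ ε_B·e^{−2(r_A/9)M}·e^{−(r_A/9)ρ} — *"an estimate has the factor e^{−δ₀M}"* / *"multiplied by
    e^{−2δ₀M}"* (printed rate δ₀; ours is the derived r_A/9 ≤ δ₀: D-b06.18/19, a decay rate may always be decreased
    in the CONCLUSIONS of [3] § 5, never silently in print's favour).
(b) §2 — THE ABSORPTION (pure linear algebra on the functions on a finite set 𝔅, kernels = `B9Thm34Inv.entry`,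
    multipliers = `B9Thm37Sum.mulOp`): B9's own step from (3.97) to *"the differences □̃Q′(G′²_{□₀} − G′²_□)Q′*□"*:
    `absorb`: χ·D·(h·T) = χ·(1_{χ≠0}·D·1_{h≠0})·(h·T) for ANY multipliers χ, h and operators D, T; and
    `window_small_factor`: if the kernel of D obeys the (1.12)-shape ONLY on supp χ × supp h (with a row weight w(y),
    the printed "usual factors") and both supports lie at depth ≥ M, then the absorbed operator 1_{χ≠0}·D·1_{h≠0} has
    the GLOBAL entrywise majorant `w(y)·e^{−2δM}·e^{−δ′ρ(y,y′)}`.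
(c) §3 — THE B9 CONSUMER.  `hasMajorant_absorbed_of_window` gives exactly the hypothesis `hD` of
    `B9Eq395Small.term397_majorant` / `smallFactor_term_majorant` for the absorbed operator, and
    `term397_majorant_of_window` has LITERALLY the conclusion of `B9Eq395Small.term397_majorant` (the majorant
    1_{S_□}(y′)·κ_De^{−2δ₀D_□}B₀C·c₁(δ₀, b−ρ)·e^{−ρδ₀d(y,y′)} of □̃·D·h_□C_□h_□) with `hD` REPLACED by the weaker,
    window-only hypothesis `hDwin` (the shape on supp □̃ × supp h_□ with depth function β) plus the two depth facts
    `hχβ`, `hhβ` (*"the distance from □̃ to □̃₀ᶜ is at least M"*; B6: □ of size 2M *"in the middle"* of □̃ of size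
    4M, supp h_□ ⊂ □).  Nothing in `…B9Eq395Small` is modified; its `hD` (cell GAPS G-B9-05, b09: "named hypothesis,
    never derived") is now DERIVABLE from `hDwin`, and `hDwin` is what §1 produces in the (5.6)-class.
(d) §4 — THE B6 READING of line 3 without the B9 geometry: `line3_entry_le`, the first step of the (2.83)-type kernel
    chain for □·D·h_□C_□h_□ (member 1 ≤ e^{−2δM} × the single sum over supp h_□), over any finite 𝔅.

WHAT THIS FILE CERTIFIES (kernel; value = the p. 238 sentence / the (3.97) paragraph settled as an implication
between printed-shape statements with explicit uniform constants, NOT summit progress):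
1. `qAinv_mul_transpose_eq`, `qggq_window_agree`, `qggq_window_deep` (§1);
2. `suppInd` + `mulOp_mul_suppInd`, `suppInd_mul_mulOp`, `absorb`, `mulOp_single`, `entry_mulOp_mul`,
   `entry_mul_mulOp`, `entry_sandwich`, `window_small_factor` (§2);
3. `hasMajorant_absorbed_of_window`, `term397_majorant_of_window` (§3);
4. `line3_entry_le` (§4).

WHAT IS NOT REPRODUCED (NAMED hypotheses of printed shape, or not modelled; cell rows GAPS C-b06g7-1, G-B9-05 as
amended, D-b06.19): (i) that B6's Δ′_a (2.14) and Q′ (2.5)–(2.9) on T_η satisfy the placed (5.6) / the decay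
hypothesis with respect to the multiscale distance d of (2.46) with M-, k-uniform constants — this is the content of
the random walks (2.50)–(2.67) (*"This estimate follows from the random walk representations (2.50)"*), typed in the
cell as hypotheses of `…B6RandomWalk`; §1 certifies the MECHANISM inside the (5.6)-class of [3] § 5 and §3 keeps the
window shape as the interface hypothesis `hDwin`; (ii) the scale weights: §1 is unweighted (one profile K), whereas
the printed "usual factors" carry (L^jη)-powers — in §§2–3 they are the free row weight w(y) = κ_D(P y)⁻¹, never
derived here; (iii) G′(□̃)'s boundary condition enters only as `hAeq` (agreement of the two kernels on the window)
and `hfarn` (depth 0 off the window); (iv) the depth facts dist(□, □̃ᶜ) = M, supp h_□ ⊂ □ are the hypotheses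
`hχβ`, `hhβ`; (v) the remaining hypotheses of `term397_majorant` (hCl = (2.81)/(3.89)-type bound of C_□, hST, h261,
htri, …) are carried unchanged; (vi) the printed rates/constants (e^{−δ₀M}, e^{−2δ₀M}) versus ours (r_A/9,
explicit ε_B): a typing divergence recorded in D-b06.19, not a claim about the print.
-/

namespace Literature.MathematicalPhysics.QuantumFieldTheory.Balaban1983to89.B6DomainTerm282

open Finset Real Matrix
open B4Sect5Torus (IsPseudoDist Hyp56)
open B6DomainChange
open B9Thm37Sum (mulOp mulOp_apply)
open B9Thm34Inv (entry)

/-! ## §1  The window (1.12)-shape of `Q′G′²Q′*` on two carriers (B6 p. 238: *"the operator with G′(□̃)² − G′² is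
small and an estimate has the factor e^{−δ₀M} because of the usual estimate of the type (1.12) [3] connected with a
change of a domain"*) -/

section Window

variable {S : Type*} {ρ : S → S → ℝ} {β : S → ℝ} {K : ℝ → ℝ}
variable {n₁ q₁ n₂ q₂ m w : Type*}

/-- `Q′G′(Q′G′)ᵀ = Q′(G′G′)Q′ᵀ = Q′G′²Q′*` for a symmetric `Δ′_a` (Q′* = transpose, weights absorbed): the `B` of
`qggq_window_agree` IS the printed Q′G′²Q′* resp. Q′G′(□̃)²Q′*. [folklore] -/
theorem qAinv_mul_transpose_eq [Fintype n₁] [DecidableEq n₁] [Fintype q₁] {A : Matrix n₁ n₁ ℝ} (hA : A.IsSymm)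
    (Q : Matrix q₁ n₁ ℝ) : Q * A⁻¹ * (Q * A⁻¹).transpose = Q * (A⁻¹ * A⁻¹) * Q.transpose := by
  rw [transpose_mul_inv_eq hA Q, Matrix.mul_assoc, Matrix.mul_assoc, Matrix.mul_assoc]

/-- **The window agreement of `Q′G′²Q′*`** (Step B of `B6DomainChange.projection_window_agree`, exported): two
carriers `n₁ ⊇ m ⊆ n₂` (window `m`, positions `pmw`), block families `q₁ ⊇ w ⊆ q₂`; on each carrier a kernel `A_c`
with the placed (5.6) and a decaying `Q_c`; the compressions of `A₁, A₂` and of `Q₁, Q₂` to the window AGREE and the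
depth vanishes off the window.  Then the compressions of `B_c = Q_cA_c⁻¹(Q_cA_c⁻¹)ᵀ` (= Q′G′²Q′*, resp.
Q′G′(□̃)²Q′*) differ by a kernel of the (1.12)-shape `(epsB, rA/9)` — constants depending on the structural
constants `(K, γ₀, c₀, δ₀, c_Q)` only.  OURS (the print derives it from the random walks (2.50)).
[cite: Balaban1984PropagatorsII, (2.82) p.237 + p.238] -/
theorem qggq_window_agree [Fintype n₁] [DecidableEq n₁] [Fintype n₂] [DecidableEq n₂] [Fintype m] [DecidableEq m]
    (hρ : IsPseudoDist ρ) (hβ : IsDepth ρ β) (hK : ∀ a, 0 < a → 0 ≤ K a)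
    {γ₀ c₀ δ₀ cQ : ℝ} (hγ : 0 < γ₀) (hc : 0 < c₀) (hδ : 0 < δ₀) (hcQ : 0 ≤ cQ)
    {pn₁ : n₁ → S} {pq₁ : q₁ → S} {pn₂ : n₂ → S} {pq₂ : q₂ → S} {pmw : m → S} {pww : w → S}
    {e₁ : m → n₁} {f₁ : w → q₁} {e₂ : m → n₂} {f₂ : w → q₂}
    (hm₁ : pn₁ ∘ e₁ = pmw) (hw₁ : pq₁ ∘ f₁ = pww) (hm₂ : pn₂ ∘ e₂ = pmw) (hw₂ : pq₂ ∘ f₂ = pww)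
    (he₁ : Function.Injective e₁) (he₂ : Function.Injective e₂)
    (hfarn₁ : ∀ z, (¬ ∃ u, e₁ u = z) → β (pn₁ z) = 0) (hfarn₂ : ∀ z, (¬ ∃ u, e₂ u = z) → β (pn₂ z) = 0)
    (hPn₁ : Profile ρ pn₁ K) (hPn₂ : Profile ρ pn₂ K)
    {A₁ : Matrix n₁ n₁ ℝ} {Q₁ : Matrix q₁ n₁ ℝ} {A₂ : Matrix n₂ n₂ ℝ} {Q₂ : Matrix q₂ n₂ ℝ}
    (hA₁ : Hyp56 (fun i j => ρ (pn₁ i) (pn₁ j)) A₁ γ₀ c₀ δ₀)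
    (hA₂ : Hyp56 (fun i j => ρ (pn₂ i) (pn₂ j)) A₂ γ₀ c₀ δ₀)
    (hQ₁ : Decay ρ pq₁ pn₁ cQ δ₀ Q₁) (hQ₂ : Decay ρ pq₂ pn₂ cQ δ₀ Q₂)
    (hAeq : A₁.submatrix e₁ e₁ = A₂.submatrix e₂ e₂) (hQeq : Q₁.submatrix f₁ e₁ = Q₂.submatrix f₂ e₂) :
    Shape ρ β pww pww (epsB K γ₀ c₀ δ₀ cQ) (rA K γ₀ c₀ δ₀ / 3 / 3)
      ((Q₁ * A₁⁻¹ * (Q₁ * A₁⁻¹).transpose).submatrix f₁ f₁ -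
        (Q₂ * A₂⁻¹ * (Q₂ * A₂⁻¹).transpose).submatrix f₂ f₂) := by
  have hδ₁pos : 0 < B4Sect5Torus.rate K γ₀ c₀ δ₀ := B4Sect5Torus.rate_pos hK hγ hc.le hδ
  have hδ₁δ₀ : B4Sect5Torus.rate K γ₀ c₀ δ₀ ≤ δ₀ := B4Sect5Torus.rate_le_delta0 K γ₀ c₀ hδ
  have hd : 0 < rA K γ₀ c₀ δ₀ := rA_pos hK hγ hc hδ
  have hd1 : rA K γ₀ c₀ δ₀ ≤ B4Sect5Torus.rate K γ₀ c₀ δ₀ := rA_le hK hγ hc hδ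
  have h2γ : (0 : ℝ) ≤ 2 / γ₀ := by positivity
  have hεG := epsG_nonneg hK hγ hc hδ
  have hεV := epsV_nonneg hK hγ hc hδ hcQ
  have hcV := cV_nonneg hK hγ hc hδ hcQ
  -- Step G : decays and window agreement of G_c = A_c⁻¹ at rate rA
  have hG₁ : Decay ρ pn₁ pn₁ (2 / γ₀) (rA K γ₀ c₀ δ₀) A₁⁻¹ :=
    (Decay.inv_of_hyp56 hK hγ hc.le hδ hρ hPn₁ hA₁).mono hρ h2γ le_rfl hd1
  have hG₂ : Decay ρ pn₂ pn₂ (2 / γ₀) (rA K γ₀ c₀ δ₀) A₂⁻¹ :=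
    (Decay.inv_of_hyp56 hK hγ hc.le hδ hρ hPn₂ hA₂).mono hρ h2γ le_rfl hd1
  have hWA : Shape ρ β pmw pmw 0 (B4Sect5Torus.rate K γ₀ c₀ δ₀)
      (A₁.submatrix e₁ e₁ - A₂.submatrix e₂ e₂) := by
    rw [hAeq, sub_self]; exact Shape.zero pmw pmw le_rfl _
  have hWG : Shape ρ β pmw pmw (epsG K γ₀ c₀ δ₀) (rA K γ₀ c₀ δ₀)
      ((A₁⁻¹).submatrix e₁ e₁ - (A₂⁻¹).submatrix e₂ e₂) :=
    wa_inv hρ hβ hK hγ hc hδ hm₁ hm₂ he₁ he₂ hfarn₁ hfarn₂ hPn₁ hPn₂ hA₁ hA₂ le_rfl hδ₁pos le_rfl hWA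
  -- Step Q
  have hQd₁ : Decay ρ pq₁ pn₁ cQ (rA K γ₀ c₀ δ₀) Q₁ := hQ₁.mono hρ hcQ le_rfl (by linarith)
  have hQd₂ : Decay ρ pq₂ pn₂ cQ (rA K γ₀ c₀ δ₀) Q₂ := hQ₂.mono hρ hcQ le_rfl (by linarith)
  have hWQ : Shape ρ β pww pmw 0 (rA K γ₀ c₀ δ₀) (Q₁.submatrix f₁ e₁ - Q₂.submatrix f₂ e₂) := by
    rw [hQeq, sub_self]; exact Shape.zero pww pmw le_rfl _
  -- Step V = Q * G (rate rA → rA/3)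
  have hWV : Shape ρ β pww pmw (epsV K γ₀ c₀ δ₀ cQ) (rA K γ₀ c₀ δ₀ / 3)
      ((Q₁ * A₁⁻¹).submatrix f₁ e₁ - (Q₂ * A₂⁻¹).submatrix f₂ e₂) :=
    wa_mul hρ hβ hK hw₁ hm₁ hm₁ hw₂ hm₂ hm₂ he₁ he₂ hfarn₁ hfarn₂ hPn₁ hPn₂ hd hcQ h2γ
      le_rfl hεG hQd₁ hQd₂ hG₁ hG₂ hWQ hWG
  have hV₁ : Decay ρ pq₁ pn₁ (cV K γ₀ c₀ δ₀ cQ) (rA K γ₀ c₀ δ₀ / 3) (Q₁ * A₁⁻¹) :=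
    (Decay.mul hρ hPn₁ hd hcQ h2γ hQd₁ hG₁).mono hρ hcV le_rfl (by linarith)
  have hV₂ : Decay ρ pq₂ pn₂ (cV K γ₀ c₀ δ₀ cQ) (rA K γ₀ c₀ δ₀ / 3) (Q₂ * A₂⁻¹) :=
    (Decay.mul hρ hPn₂ hd hcQ h2γ hQd₂ hG₂).mono hρ hcV le_rfl (by linarith)
  -- Step B = V * Vᵀ (rate rA/3 → rA/9)
  have hd3 : 0 < rA K γ₀ c₀ δ₀ / 3 := by positivity
  exact wa_mul hρ hβ hK hw₁ hm₁ hw₁ hw₂ hm₂ hw₂ he₁ he₂ hfarn₁ hfarn₂ hPn₁ hPn₂ hd3 hcV hcV hεV hεV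
    hV₁ hV₂ (hV₁.transpose hρ) (hV₂.transpose hρ) hWV (wa_transpose hρ hWV)

/-- **At two window indices of depth ≥ M** the kernels of Q′G′²Q′* and Q′G′(□̃)²Q′* differ by at most
`epsB·e^{−2(rA/9)M}·e^{−(rA/9)ρ}` — *"an estimate has the factor e^{−δ₀M}"* (B6 p. 238) / *"multiplied by e^{−2δ₀M}"*
(B9 p. 412), with our derived rate.  OURS. [cite: Balaban1984PropagatorsII, p.238; Balaban1985BackgroundPropagators, (3.97) p.412] -/
theorem qggq_window_deep [Fintype n₁] [DecidableEq n₁] [Fintype n₂] [DecidableEq n₂] [Fintype m] [DecidableEq m]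
    (hρ : IsPseudoDist ρ) (hβ : IsDepth ρ β) (hK : ∀ a, 0 < a → 0 ≤ K a)
    {γ₀ c₀ δ₀ cQ : ℝ} (hγ : 0 < γ₀) (hc : 0 < c₀) (hδ : 0 < δ₀) (hcQ : 0 ≤ cQ)
    {pn₁ : n₁ → S} {pq₁ : q₁ → S} {pn₂ : n₂ → S} {pq₂ : q₂ → S} {pmw : m → S} {pww : w → S}
    {e₁ : m → n₁} {f₁ : w → q₁} {e₂ : m → n₂} {f₂ : w → q₂}
    (hm₁ : pn₁ ∘ e₁ = pmw) (hw₁ : pq₁ ∘ f₁ = pww) (hm₂ : pn₂ ∘ e₂ = pmw) (hw₂ : pq₂ ∘ f₂ = pww)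
    (he₁ : Function.Injective e₁) (he₂ : Function.Injective e₂)
    (hfarn₁ : ∀ z, (¬ ∃ u, e₁ u = z) → β (pn₁ z) = 0) (hfarn₂ : ∀ z, (¬ ∃ u, e₂ u = z) → β (pn₂ z) = 0)
    (hPn₁ : Profile ρ pn₁ K) (hPn₂ : Profile ρ pn₂ K)
    {A₁ : Matrix n₁ n₁ ℝ} {Q₁ : Matrix q₁ n₁ ℝ} {A₂ : Matrix n₂ n₂ ℝ} {Q₂ : Matrix q₂ n₂ ℝ}
    (hA₁ : Hyp56 (fun i j => ρ (pn₁ i) (pn₁ j)) A₁ γ₀ c₀ δ₀)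
    (hA₂ : Hyp56 (fun i j => ρ (pn₂ i) (pn₂ j)) A₂ γ₀ c₀ δ₀)
    (hQ₁ : Decay ρ pq₁ pn₁ cQ δ₀ Q₁) (hQ₂ : Decay ρ pq₂ pn₂ cQ δ₀ Q₂)
    (hAeq : A₁.submatrix e₁ e₁ = A₂.submatrix e₂ e₂) (hQeq : Q₁.submatrix f₁ e₁ = Q₂.submatrix f₂ e₂)
    {M : ℝ} (hM : 0 < M) {u v : w} (hu : M ≤ β (pww u)) (hv : M ≤ β (pww v)) :
    |(Q₁ * A₁⁻¹ * (Q₁ * A₁⁻¹).transpose) (f₁ u) (f₁ v) -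
        (Q₂ * A₂⁻¹ * (Q₂ * A₂⁻¹).transpose) (f₂ u) (f₂ v)| ≤
      epsB K γ₀ c₀ δ₀ cQ * Real.exp (-(2 * (rA K γ₀ c₀ δ₀ / 3 / 3) * M)) *
        Real.exp (-(rA K γ₀ c₀ δ₀ / 3 / 3 * ρ (pww u) (pww v))) := by
  have hS := qggq_window_agree hρ hβ hK hγ hc hδ hcQ hm₁ hw₁ hm₂ hw₂ he₁ he₂ hfarn₁ hfarn₂ hPn₁ hPn₂
    hA₁ hA₂ hQ₁ hQ₂ hAeq hQeq
  have hr : 0 < rA K γ₀ c₀ δ₀ / 3 / 3 := by have := rA_pos hK hγ hc hδ; positivity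
  have h := (hS.apply_le_of_depth (epsB_nonneg hK hγ hc hδ hcQ) hr hM hu hv).1
  simpa [Matrix.sub_apply, Matrix.submatrix_apply] using h

end Window

/-! ## §2  Indicator absorption and the global small factor (B9 p. 412: from (3.97) to *"the differences
□̃Q′(G′²_{□₀} − G′²_□)Q′*□ can be estimated by the usual factors multiplied by e^{−2δ₀M}"*) -/

section Entries

variable {S : Type}

/-- the indicator of the support of a lattice function χ (for χ = □̃ the cube itself; for h_□ a set ⊂ □). [folklore] -/
noncomputable def suppInd (χ : S → ℝ) : S → ℝ := fun y => if χ y = 0 then 0 else 1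

/-- [folklore] -/
theorem suppInd_of_ne {χ : S → ℝ} {y : S} (h : χ y ≠ 0) : suppInd χ y = 1 := by
  simp [suppInd, h]

/-- [folklore] -/
theorem suppInd_of_eq {χ : S → ℝ} {y : S} (h : χ y = 0) : suppInd χ y = 0 := by
  simp [suppInd, h]

/-- [folklore] -/
theorem suppInd_nonneg (χ : S → ℝ) (y : S) : 0 ≤ suppInd χ y := by
  unfold suppInd; split_ifs <;> norm_num

/-- [folklore] -/
theorem abs_suppInd_le_one (χ : S → ℝ) (y : S) : |suppInd χ y| ≤ 1 := by
  unfold suppInd; split_ifs <;> norm_num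

/-- χ·1_{χ≠0} = χ. [folklore] -/
theorem mul_suppInd (χ : S → ℝ) (y : S) : χ y * suppInd χ y = χ y := by
  unfold suppInd; split_ifs with h
  · rw [h, zero_mul]
  · rw [mul_one]

/-- as multiplication operators: χ·1_{χ≠0} = χ. [folklore] -/
theorem mulOp_mul_suppInd (χ : S → ℝ) : mulOp χ * mulOp (suppInd χ) = mulOp χ := by
  rw [B9Eq395Small.mulOp_mul_mulOp]
  congr 1
  funext y
  exact mul_suppInd χ y

/-- as multiplication operators: 1_{h≠0}·h = h. [folklore] -/
theorem suppInd_mul_mulOp (h : S → ℝ) : mulOp (suppInd h) * mulOp h = mulOp h := by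
  rw [B9Eq395Small.mulOp_comm]; exact mulOp_mul_suppInd h

/-- **The absorption** (B9 p. 412, the step from the operator (3.97) to *"the differences □̃Q′(…)Q′*□"*; B6 (2.82):
□ in front, h_□ behind): χ·D·(h·T) = χ·(1_{χ≠0}·D·1_{h≠0})·(h·T) — only the window block of the kernel of D is ever
used. [cite: Balaban1985BackgroundPropagators, (3.97) p.412] -/
theorem absorb (χ h : S → ℝ) (D T : Module.End ℝ (S → ℝ)) :
    mulOp χ * D * (mulOp h * T) =
      mulOp χ * (mulOp (suppInd χ) * D * mulOp (suppInd h)) * (mulOp h * T) := by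
  conv_lhs => rw [← mulOp_mul_suppInd χ, ← suppInd_mul_mulOp h]
  simp only [mul_assoc]

variable [DecidableEq S]

/-- a multiplier applied to a point mass: h·δ_{y′} = h(y′)δ_{y′} (any finite set; `B9Eq395Small.mulOp_single` is the
𝔅-instance). [folklore] -/
theorem mulOp_single (h : S → ℝ) (y' : S) :
    mulOp h (Pi.single y' (1 : ℝ)) = h y' • (Pi.single y' (1 : ℝ) : S → ℝ) := by
  funext x
  rw [mulOp_apply, Pi.smul_apply, smul_eq_mul]
  by_cases hx : x = y'
  · rw [hx]
  · rw [Pi.single_eq_of_ne hx, mul_zero, mul_zero]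

/-- kernel of a left multiplier: (s·D)(y, y′) = s(y)D(y, y′). [folklore] -/
theorem entry_mulOp_mul (s : S → ℝ) (D : Module.End ℝ (S → ℝ)) (y y' : S) :
    entry (mulOp s * D) y y' = s y * entry D y y' := by
  simp only [B9Thm34Inv.entry, Module.End.mul_apply, mulOp_apply]

/-- kernel of a right multiplier: (D·t)(y, y′) = D(y, y′)t(y′). [folklore] -/
theorem entry_mul_mulOp (D : Module.End ℝ (S → ℝ)) (t : S → ℝ) (y y' : S) :
    entry (D * mulOp t) y y' = entry D y y' * t y' := by
  simp only [B9Thm34Inv.entry, Module.End.mul_apply]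
  rw [mulOp_single, map_smul, Pi.smul_apply, smul_eq_mul, mul_comm]

/-- kernel of a two-sided multiplier sandwich: (s·D·t)(y, y′) = s(y)D(y, y′)t(y′). [folklore] -/
theorem entry_sandwich (s t : S → ℝ) (D : Module.End ℝ (S → ℝ)) (y y' : S) :
    entry (mulOp s * D * mulOp t) y y' = s y * entry D y y' * t y' := by
  rw [entry_mul_mulOp, entry_mulOp_mul]

/-- **From the window shape to the global small factor.**  If the kernel of D obeys, ONLY for y ∈ supp χ and
y′ ∈ supp h, the (1.12)-type bound `|D(y,y′)| ≤ w(y)e^{−δ′ρ(y,y′)}e^{−δ(β(y)+β(y′))}` (*"the usual factors"* w and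
e^{−δ′ρ}, times the domain-change factor in BOTH depths), and both supports lie at depth ≥ M (*"the distance from □̃
to □̃₀ᶜ is at least M"*), then the absorbed operator 1_{χ≠0}·D·1_{h≠0} has the GLOBAL entrywise majorant
`w(y)e^{−2δM}e^{−δ′ρ(y,y′)}` — *"can be estimated by the usual factors multiplied by e^{−2δ₀M}"*.
[cite: Balaban1985BackgroundPropagators, (3.97) p.412; Balaban1984PropagatorsII, p.238] -/
theorem window_small_factor {d : S → S → ℝ} {β w χ h : S → ℝ} {D : Module.End ℝ (S → ℝ)} {δ δ' M : ℝ}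
    (hδ : 0 ≤ δ)
    (hwin : ∀ y y', χ y ≠ 0 → h y' ≠ 0 →
      |entry D y y'| ≤ w y * Real.exp (-(δ' * d y y')) * Real.exp (-(δ * (β y + β y'))))
    (hw : ∀ y, 0 ≤ w y) (hχ : ∀ y, χ y ≠ 0 → M ≤ β y) (hh : ∀ y, h y ≠ 0 → M ≤ β y) (y y' : S) :
    |entry (mulOp (suppInd χ) * D * mulOp (suppInd h)) y y'| ≤
      w y * Real.exp (-(2 * δ * M)) * Real.exp (-(δ' * d y y')) := by
  have hnn : 0 ≤ w y * Real.exp (-(2 * δ * M)) * Real.exp (-(δ' * d y y')) :=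
    mul_nonneg (mul_nonneg (hw y) (Real.exp_nonneg _)) (Real.exp_nonneg _)
  rw [entry_sandwich]
  by_cases hy : χ y = 0
  · rw [suppInd_of_eq hy, zero_mul, zero_mul, abs_zero]; exact hnn
  by_cases hy' : h y' = 0
  · rw [suppInd_of_eq hy', mul_zero, abs_zero]; exact hnn
  rw [suppInd_of_ne hy, suppInd_of_ne hy', one_mul, mul_one]
  refine (hwin y y' hy hy').trans ?_
  have hdep : Real.exp (-(δ * (β y + β y'))) ≤ Real.exp (-(2 * δ * M)) :=
    Real.exp_le_exp.mpr (by nlinarith [hχ y hy, hh y' hy'])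
  calc w y * Real.exp (-(δ' * d y y')) * Real.exp (-(δ * (β y + β y')))
      ≤ w y * Real.exp (-(δ' * d y y')) * Real.exp (-(2 * δ * M)) :=
        mul_le_mul_of_nonneg_left hdep (mul_nonneg (hw y) (Real.exp_nonneg _))
    _ = w y * Real.exp (-(2 * δ * M)) * Real.exp (-(δ' * d y y')) := by ring

end Entries

/-! ## §3  The B9 consumer: the hypothesis `hD` of `B9Eq395Small.term397_majorant` DERIVED from the window-only
hypothesis, and (3.97) with that hypothesis replaced -/

section Eq397

variable {g : B9.Geometry} [Fintype g.Site] [DecidableEq g.Site] {R : ℝ} {H : Prop}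

/-- **`hD` from the window.**  The absorbed difference 1_{□̃}·D·1_{supp h_□} has the majorant of the printed shape
κ_D·e^{−2δ₀D_□}·(P y)⁻¹e^{−a_Dδ₀d(y,y″)} (= the hypothesis `hD` of `B9Eq395Small.term397_majorant` /
`smallFactor_term_majorant`), GIVEN only the (1.12)-type bound of the kernel of D on supp □̃ × supp h_□ with depth
function β (*"a distance … to a closest point where a change was made"*) and the depths ≥ D_□ of both supports.
[cite: Balaban1985BackgroundPropagators, (3.97) p.412] -/
theorem hasMajorant_absorbed_of_window (δ₀ aD κD Dsep : ℝ) (P β χ h : g.Site → ℝ)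
    (hκD : 0 ≤ κD) (hP : ∀ y, 0 < P y) (hδ₀ : 0 ≤ δ₀) {D : Module.End ℝ (g.Site → ℝ)}
    (hDwin : ∀ y y'' : g.Site, χ y ≠ 0 → h y'' ≠ 0 →
      |entry D y y''| ≤ κD * (P y)⁻¹ * Real.exp (-(aD * δ₀ * g.dist y y'')) *
        Real.exp (-(δ₀ * (β y + β y''))))
    (hχβ : ∀ y, χ y ≠ 0 → Dsep ≤ β y) (hhβ : ∀ y, h y ≠ 0 → Dsep ≤ β y) :
    B6RandomWalk.HasMajorant (g := B9Thm34Ext.toB6 g R H) (fun x : g.Site => x)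
      (mulOp (suppInd χ) * D * mulOp (suppInd h))
      (fun (a y'' : g.Site) =>
        κD * Real.exp (-(2 * δ₀ * Dsep)) * (P a)⁻¹ * Real.exp (-(aD * δ₀ * g.dist a y''))) := by
  refine (B9Thm34Inv.hasMajorant_id_iff _ _).mpr fun y y'' => ?_
  have hw : ∀ a : g.Site, 0 ≤ κD * (P a)⁻¹ := fun a => mul_nonneg hκD (inv_pos.mpr (hP a)).le
  have hsm := window_small_factor (d := g.dist) (β := β) (w := fun a => κD * (P a)⁻¹) (χ := χ) (h := h) (D := D)
    (δ := δ₀) (δ' := aD * δ₀) (M := Dsep) hδ₀ hDwin hw hχβ hhβ y y''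
  calc |entry (mulOp (suppInd χ) * D * mulOp (suppInd h)) y y''|
      ≤ κD * (P y)⁻¹ * Real.exp (-(2 * δ₀ * Dsep)) * Real.exp (-(aD * δ₀ * g.dist y y'')) := hsm
    _ = κD * Real.exp (-(2 * δ₀ * Dsep)) * (P y)⁻¹ * Real.exp (-(aD * δ₀ * g.dist y y'')) := by ring

/-- **(3.97) / the third line of (2.82) from the window** — LITERALLY the conclusion of
`B9Eq395Small.term397_majorant` (□̃·D·h_□C_□h_□ ≺ 1_{S_□}(y′)·κ_De^{−2δ₀D_□}B₀C·c₁(δ₀, b−ρ)·e^{−ρδ₀d(y,y′)}), with its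
hypothesis `hD` (the GLOBAL majorant of D with the small factor — cell GAPS G-B9-05, "never derived") REPLACED by the
weaker window-only hypothesis `hDwin` + the two depth facts `hχβ`, `hhβ`: by `absorb` the operator equals
□̃·(1_{□̃}D1_{supp h_□})·h_□C_□h_□, and `hasMajorant_absorbed_of_window` supplies `hD` for the absorbed difference.
[cite: Balaban1985BackgroundPropagators, (3.97) p.412; Balaban1984PropagatorsII, (2.82) p.237] -/
theorem term397_majorant_of_window (d : ℕ) (δ₀ aD αst ρ b κD Dsep B₀ C : ℝ) (P : g.Site → ℝ) (S : Finset g.Site)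
    (χ h β : g.Site → ℝ)
    (hκD : 0 ≤ κD) (hB₀ : 0 ≤ B₀) (hC : 0 ≤ C) (hP : ∀ y, 0 < P y) (hδ₀ : 0 ≤ δ₀) (hρ : 0 ≤ ρ) (hsplit : αst + ρ ≤ aD)
    (htri : B6RandomWalk.Triangle254 (B9Thm34Ext.toB6 g R H)) (hsymm : ∀ a b : g.Site, g.dist a b = g.dist b a)
    (hdnn : ∀ a b : g.Site, 0 ≤ g.dist a b)
    (hST : B9Ineq347.ScaleTransfer g δ₀ αst C P)
    (h261 : B6RandomWalk.Ineq261 d (B9Thm34Ext.toB6 g R H) δ₀ (b - ρ))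
    (hχ1 : ∀ y, |χ y| ≤ 1) (hh1 : ∀ y, |h y| ≤ 1) (hhS : ∀ y, h y ≠ 0 → y ∈ S)
    {D Cl : Module.End ℝ (g.Site → ℝ)}
    (hDwin : ∀ y y'' : g.Site, χ y ≠ 0 → h y'' ≠ 0 →
      |entry D y y''| ≤ κD * (P y)⁻¹ * Real.exp (-(aD * δ₀ * g.dist y y'')) *
        Real.exp (-(δ₀ * (β y + β y''))))
    (hχβ : ∀ y, χ y ≠ 0 → Dsep ≤ β y) (hhβ : ∀ y, h y ≠ 0 → Dsep ≤ β y)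
    (hCl : B6RandomWalk.HasMajorant (g := B9Thm34Ext.toB6 g R H) (fun x : g.Site => x) Cl
      (fun (y'' b' : g.Site) => B₀ * P y'' * Real.exp (-(b * δ₀ * g.dist y'' b')))) :
    B6RandomWalk.HasMajorant (g := B9Thm34Ext.toB6 g R H) (fun x : g.Site => x)
      (mulOp χ * D * (mulOp h * Cl * mulOp h))
      (fun (a b' : g.Site) => (if b' ∈ S then (1 : ℝ) else 0) *
        (κD * Real.exp (-(2 * δ₀ * Dsep)) * B₀ * C * B6.c1 d δ₀ (b - ρ)) * Real.exp (-(ρ * δ₀ * g.dist a b'))) := by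
  have e : mulOp χ * D * (mulOp h * Cl * mulOp h) =
      mulOp χ * (mulOp (suppInd χ) * D * mulOp (suppInd h)) * (mulOp h * Cl * mulOp h) := by
    rw [mul_assoc (mulOp h) Cl (mulOp h), absorb χ h D (Cl * mulOp h)]
  rw [e]
  exact B9Eq395Small.term397_majorant d δ₀ aD αst ρ b κD Dsep B₀ C P S χ h hκD hB₀ hC hP hδ₀ hρ hsplit htri
    hsymm hdnn hST h261 hχ1 hh1 hhS
    (hasMajorant_absorbed_of_window δ₀ aD κD Dsep P β χ h hκD hP hδ₀ hDwin hχβ hhβ) hCl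

end Eq397

/-! ## §4  The B6 reading of line 3 of (2.82) over any finite 𝔅: the first step of the (2.83)-type kernel chain -/

section Line3

variable {S : Type} [Fintype S] [DecidableEq S]

/-- **The kernel of □·D·h_□C_□h_□, first member ≤ second member** (B6 p. 238: *"Similar inequalities hold for kernels
of the other operators forming R, for example the operator with G′(□̃)² − G′² is small and an estimate has the factor
e^{−δ₀M}"*): with the window-only (1.12)-type bound of D on supp □ × supp h_□ (row weight w, rate δ′, depth rate δ),
both supports at depth ≥ M and |□| ≤ 1,
`|(□Dh_□C_□h_□)(y,y′)| ≤ e^{−2δM} · Σ_{y″} w(y)e^{−δ′d(y,y″)}|h_□(y″)||C_□(y″,y′)||h_□(y′)|` — the analogue, for the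
third line, of the passage from member 1 to member 2 of (2.83); the rest of the chain is `…B6Ineq283`'s.  OURS.
[cite: Balaban1984PropagatorsII, (2.82)–(2.83) p.237 + p.238] -/
theorem line3_entry_le {d : S → S → ℝ} {β w χ h : S → ℝ} {D C : Module.End ℝ (S → ℝ)} {δ δ' M : ℝ}
    (hδ : 0 ≤ δ)
    (hwin : ∀ y y', χ y ≠ 0 → h y' ≠ 0 →
      |entry D y y'| ≤ w y * Real.exp (-(δ' * d y y')) * Real.exp (-(δ * (β y + β y'))))
    (hw : ∀ y, 0 ≤ w y) (hχ : ∀ y, χ y ≠ 0 → M ≤ β y) (hh : ∀ y, h y ≠ 0 → M ≤ β y)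
    (hχ1 : ∀ y, |χ y| ≤ 1) (y y' : S) :
    |entry (mulOp χ * D * (mulOp h * C * mulOp h)) y y'| ≤
      Real.exp (-(2 * δ * M)) *
        ∑ y'', w y * Real.exp (-(δ' * d y y'')) * |h y''| * |entry C y'' y'| * |h y'| := by
  have e : mulOp χ * D * (mulOp h * C * mulOp h) =
      mulOp χ * (mulOp (suppInd χ) * D * mulOp (suppInd h)) * (mulOp h * C * mulOp h) := by
    rw [mul_assoc (mulOp h) C (mulOp h), absorb χ h D (C * mulOp h)]
  rw [e, B9Thm34Inv.entry_mul, Finset.mul_sum]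
  refine (Finset.abs_sum_le_sum_abs _ _).trans (Finset.sum_le_sum fun y'' _ => ?_)
  rw [entry_mulOp_mul, entry_sandwich h h C y'' y']
  simp only [abs_mul]
  have hsm := window_small_factor (d := d) hδ hwin hw hχ hh y y''
  have h1 : |χ y| * |entry (mulOp (suppInd χ) * D * mulOp (suppInd h)) y y''| ≤
      1 * (w y * Real.exp (-(2 * δ * M)) * Real.exp (-(δ' * d y y''))) :=
    mul_le_mul (hχ1 y) hsm (abs_nonneg _) zero_le_one
  have hA : 0 ≤ |h y''| * |entry C y'' y'| * |h y'| := by positivity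
  calc |χ y| * |entry (mulOp (suppInd χ) * D * mulOp (suppInd h)) y y''| * (|h y''| * |entry C y'' y'| * |h y'|)
      ≤ 1 * (w y * Real.exp (-(2 * δ * M)) * Real.exp (-(δ' * d y y''))) *
          (|h y''| * |entry C y'' y'| * |h y'|) := mul_le_mul_of_nonneg_right h1 hA
    _ = Real.exp (-(2 * δ * M)) * (w y * Real.exp (-(δ' * d y y'')) * |h y''| * |entry C y'' y'| * |h y'|) := by
          ring

end Line3

end Literature.MathematicalPhysics.QuantumFieldTheory.Balaban1983to89.B6DomainTerm282
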